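import Mathlib
import Literature.Computability.AlgebraicComplexity.MignonRessayreBound
import Literature.Computability.AlgebraicComplexity.PermanentIrreducible
import Summits.ValiantsHypothesis.ValiantsHypothesis.Theorems.GrenetZeonTwoDimCoefficientsGradedUnit
import Summits.ValiantsHypothesis.ValiantsHypothesis.Theorems.GrenetZeonTwoDimCoefficientsTopForms

/-!
# Crux `GrenetZeon.TwoDimCoefficients` (stmt-ValiantsHypothesis-8062), line `dim2_cases` —
# `UnitDichotomyTop`: the provable half of the unit dichotomy

**Theorem** (`sq_le_of_det_eq_C_add_perPow_mul`).  Let `A` be an `m × m` matrix of affine linear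
forms in the `n²` variables `x_{ij}` (`n ≥ 3`) over `ℂ` with
`det A = c + per_n^{k+1} · Q`, `c ≠ 0`, and suppose the top homogeneous form `Q_top` of `Q` is
NOT divisible by `per_n`.  Then `n² ≤ 2m + 2`.

This is the provable sub-case of the registered stub `stub_unitDichotomy` (a zero-free `det A` is
`c + per·q` by `exists_eq_C_add_perPoly_mul`; extract the maximal power of `per`); the complementary
sub-case `per ∣ Q_top` contains the squares `c·(1 + per S)²`, where every zero of `det A` is a
rank-`≤ 1` point of its Hessian and no method is on record (crux workfile `UNIT-CASE-NOTE.md`,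
calibration file `GrenetZeonTwoDimCoefficientsSquareInstance.lean`).

Proof (no asymptotics — TOP FORMS instead of a "Mignon–Ressayre point pushed to infinity").  Put
`h = det A`, `P = per_n`, `M := (k+1)·Q·Hess P + P·Hess Q` (a polynomial matrix; `Hess` = the matrix of
second partials), `g := det M`.
1. At any zero `x` of `h`: `P(x) ≠ 0`, and `Hess h(x) = P(x)^k · M(x) + (∇P(x) aᵀ + a ∇P(x)ᵀ)`
   (`hess0_pow_succ_mul`), so `rank M(x) ≤ rank Hess h(x) + 2 ≤ 2m + 2` (`rank_hess0_det_le`).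
2. `g` does not vanish identically on `Z(h)`: otherwise `g^r = h·w` (Nullstellensatz), and comparing
   TOP homogeneous components (`homogeneousComponent_pow_of_le`, `homogeneousComponent_mul_totalDegree`)
   gives `(g_top)^r = P^{k+1}·Q_top·w_top`, so `P ∣ g_top` (`P` is prime: `perPoly_irreducible`).  But
   `g_top = det M_top` with `M_top = (k+1)·Q_top·Hess P + P·(Hess Q)_{top}` (`homogeneousComponent_det_of_le`),
   and at a point `x₀ ∈ Z(P)` with `Q_top(x₀) ≠ 0`, `det Hess P(x₀) ≠ 0` (exists by prime avoidance:
   `P ∤ Q_top` by hypothesis, `P ∤ det Hess P` because of the Mignon–Ressayre point, tree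
   `hess0_transl_mrPoint_perPoly` + `mrHess_mulVec_injective`) we get `g_top(x₀) ≠ 0 = P(x₀)`.
3. So some `x ∈ Z(h)` has `det M(x) ≠ 0`, i.e. `rank M(x) = n²`, whence `n² ≤ 2m + 2`.

HONEST FRAMING: a conditional-free lemma toward an ASIDE item; it does not bear on `VP ≠ VNP`, and it
leaves the power-unit sub-case of the stub open.

References: T. Mignon, N. Ressayre, Int. Math. Res. Not. 2004:79, Thm. 1.1 and §§2–3;
J. M. Landsberg, *Geometry and Complexity Theory* (2017), §6.4.6; Hilbert's Nullstellensatz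
(Mathlib `MvPolynomial.vanishingIdeal_zeroLocus_eq_radical`).
-/

-- single-conjunct layout `Summits/ValiantsHypothesis/ValiantsHypothesis`: the duplicated namespace
-- component is mandated by the tree.
set_option linter.dupNamespace false

noncomputable section

open MvPolynomial Matrix
open Literature.Computability.AlgebraicComplexity

namespace Summit.ValiantsHypothesis.ValiantsHypothesis.Theorems.GrenetZeonTwoDimCoefficients

/-! ### The polynomial Hessian matrix and degree bookkeeping for partial derivatives -/

section PolyHessian

variable {σ : Type*} {K : Type*} [Field K]

/-- The Hessian at a point is the evaluation of the polynomial Hessian: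
`H(f(X + x))(0) = (∂_s∂_t f (x))_{s,t}`. [folklore] -/
theorem hess0_transl_eq_map (x : σ → K) (f : MvPolynomial σ K) :
    hess0 (transl x f) = (Matrix.of fun s t => pderiv s (pderiv t f)).map (eval x) := by
  ext s t
  rw [hess0_transl, Matrix.map_apply, Matrix.of_apply]

/-- A non-zero partial derivative has total degree at most `deg f − 1`. [folklore] -/
theorem totalDegree_pderiv_succ_le {f : MvPolynomial σ K} {i : σ} (h : pderiv i f ≠ 0) :
    (pderiv i f).totalDegree + 1 ≤ f.totalDegree := by
  classical
  obtain ⟨s, hs, hdeg⟩ := Finset.exists_mem_eq_sup ((pderiv i f).support)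
    (support_nonempty.mpr h) (fun s => s.sum fun _ e => e)
  have hc : coeff s (pderiv i f) ≠ 0 := mem_support_iff.mp hs
  rw [coeff_pderiv] at hc
  have hc' : coeff (s + Finsupp.single i 1) f ≠ 0 := left_ne_zero_of_mul hc
  have hle := le_totalDegree (mem_support_iff.mpr hc')
  have hsum : ((s + Finsupp.single i 1).sum fun _ e => e) = (s.sum fun _ e => e) + 1 := by
    rw [Finsupp.sum_add_index' (fun _ => rfl) (fun _ _ _ => rfl), Finsupp.sum_single_index rfl]
  rw [totalDegree, hdeg]
  omega

/-- A non-zero second partial derivative has total degree at most `deg f − 2`. [folklore] -/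
theorem totalDegree_pderiv_pderiv_add_two_le {f : MvPolynomial σ K} {s t : σ}
    (h : pderiv s (pderiv t f) ≠ 0) : (pderiv s (pderiv t f)).totalDegree + 2 ≤ f.totalDegree := by
  have h1 := totalDegree_pderiv_succ_le h
  have ht : pderiv t f ≠ 0 := fun h0 => h (by rw [h0, map_zero])
  have h2 := totalDegree_pderiv_succ_le ht
  omega

/-- Second partials of a form of degree `N` are forms of degree `N − 2`. [folklore] -/
theorem isHomogeneous_pderiv_pderiv {f : MvPolynomial σ K} {N : ℕ} (hf : f.IsHomogeneous N)
    (s t : σ) : (pderiv s (pderiv t f)).IsHomogeneous (N - 2) := by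
  have h := (hf.pderiv (i := t)).pderiv (i := s)
  rwa [show N - 1 - 1 = N - 2 by omega] at h

end PolyHessian

/-! ### The theorem -/

section UnitTop

/-- At a zero of an affine determinant the Hessian has rank `≤ 2m` (the tree's `rank_hess0_det_le`
after translation). [cite: MignonRessayre2004, §2] -/
theorem rank_hess0_transl_det_le' {n m : ℕ}
    (A : Matrix (Fin m) (Fin m) (MvPolynomial (Fin n × Fin n) ℂ))
    (hA : ∀ i j, (A i j).totalDegree ≤ 1) (p : Fin n × Fin n → ℂ) (hp : eval p A.det = 0) :
    (hess0 (transl p A.det)).rank ≤ 2 * m := by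
  rw [AlgHom.map_det]
  refine rank_hess0_det_le _ (fun i j => ?_) ?_
  · rw [AlgHom.mapMatrix_apply, Matrix.map_apply]
    exact (totalDegree_transl_le p (A i j)).trans (hA i j)
  · rw [← AlgHom.map_det, constantCoeff_transl, hp]

/-- The determinant of the polynomial Hessian of the permanent does not vanish at the Mignon–Ressayre
point (so it is not divisible by `per_n`). [cite: MignonRessayre2004, §3] -/
theorem eval_mrPoint_det_hessP_perPoly_ne_zero (m : ℕ) :
    eval (mrPoint ℂ m)
      (Matrix.of fun s t => pderiv s (pderiv t (perPoly (Fin (m + 3)) ℂ))).det ≠ 0 := by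
  rw [RingHom.map_det, RingHom.mapMatrix_apply, ← hess0_transl_eq_map, hess0_transl_mrPoint_perPoly,
    Matrix.det_smul]
  refine mul_ne_zero (pow_ne_zero _ (by exact_mod_cast Nat.factorial_ne_zero m)) ?_
  have hU : IsUnit (mrHess ℂ m) :=
    Matrix.mulVec_injective_iff_isUnit.mp mrHess_mulVec_injective
  exact ((Matrix.isUnit_iff_isUnit_det _).mp hU).ne_zero

/-- **`UnitDichotomyTop`.**  If an affine `m × m` determinant over `ℂ` in the `n²` variables
(`n ≥ 3`) has the form `det A = c + per_n^{k+1}·Q` with `c ≠ 0` and the top homogeneous form of `Q`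
not divisible by `per_n`, then `n² ≤ 2m + 2`.  See the module docstring for the proof.
[cite: MignonRessayre2004, Thm. 1.1] -/
theorem sq_le_of_det_eq_C_add_perPow_mul {n : ℕ} (hn : 3 ≤ n) {m : ℕ}
    (A : Matrix (Fin m) (Fin m) (MvPolynomial (Fin n × Fin n) ℂ))
    (hA : ∀ i j, (A i j).totalDegree ≤ 1) {c : ℂ} (hc : c ≠ 0) {k : ℕ}
    {Q : MvPolynomial (Fin n × Fin n) ℂ}
    (hdet : A.det = C c + perPoly (Fin n) ℂ ^ (k + 1) * Q)
    (htop : ¬ perPoly (Fin n) ℂ ∣ homogeneousComponent Q.totalDegree Q) :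
    n ^ 2 ≤ 2 * m + 2 := by
  classical
  obtain ⟨n', rfl⟩ : ∃ n', n = n' + 3 := ⟨n - 3, by omega⟩
  have hQ0 : Q ≠ 0 := by
    rintro rfl
    exact htop (by rw [map_zero]; exact dvd_zero _)
  -- notation
  set P : MvPolynomial (Fin (n' + 3) × Fin (n' + 3)) ℂ := perPoly (Fin (n' + 3)) ℂ with hPdef
  set d : ℕ := Q.totalDegree with hd
  set Qt := homogeneousComponent d Q with hQt
  set D : ℕ := d + (n' + 1) with hD
  -- basic facts about `P`
  haveI : Nonempty (Fin (n' + 3)) := ⟨0⟩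
  have hPprime : Prime P := (perPoly_irreducible (n := Fin (n' + 3)) (R := ℂ)).prime
  have hPhom : P.IsHomogeneous (n' + 3) := by
    simpa only [Fintype.card_fin] using
      (perPoly_isHomogeneous : (perPoly (Fin (n' + 3)) ℂ).IsHomogeneous _)
  have hPdeg : P.totalDegree ≤ n' + 3 := hPhom.totalDegree_le
  have hQt0 : Qt ≠ 0 := homogeneousComponent_totalDegree_ne_zero hQ0
  -- second partials: degrees and top parts
  have hHP : ∀ s t : Fin (n' + 3) × Fin (n' + 3), (pderiv s (pderiv t P)).IsHomogeneous (n' + 1) :=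
    fun s t => by simpa using isHomogeneous_pderiv_pderiv hPhom s t
  have hHPdeg : ∀ s t : Fin (n' + 3) × Fin (n' + 3), (pderiv s (pderiv t P)).totalDegree ≤ n' + 1 :=
    fun s t => (hHP s t).totalDegree_le
  have hHQtop : ∀ s t : Fin (n' + 3) × Fin (n' + 3),
      homogeneousComponent (d + (n' + 1)) (P * pderiv s (pderiv t Q)) =
      P * homogeneousComponent (d - 2) (pderiv s (pderiv t Q)) := by
    intro s t
    by_cases hz : pderiv s (pderiv t Q) = 0
    · rw [hz, mul_zero, map_zero, map_zero, mul_zero]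
    · have h2 := totalDegree_pderiv_pderiv_add_two_le (f := Q) (s := s) (t := t) hz
      have hidx : d + (n' + 1) = (n' + 3) + (d - 2) := by omega
      rw [hidx, homogeneousComponent_mul_of_le hPdeg (by omega), homogeneousComponent_eq_self hPhom]
  have hHQdeg : ∀ s t : Fin (n' + 3) × Fin (n' + 3),
      (P * pderiv s (pderiv t Q)).totalDegree ≤ D := by
    intro s t
    by_cases hz : pderiv s (pderiv t Q) = 0
    · rw [hz, mul_zero, totalDegree_zero]; exact Nat.zero_le _
    · have h2 := totalDegree_pderiv_pderiv_add_two_le (f := Q) (s := s) (t := t) hz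
      refine (totalDegree_mul _ _).trans ?_
      rw [hD]; omega
  -- the polynomial matrix `M = (k+1) Q · Hess P + P · Hess Q` and its top part
  set Mp : Matrix (Fin (n' + 3) × Fin (n' + 3)) (Fin (n' + 3) × Fin (n' + 3))
      (MvPolynomial (Fin (n' + 3) × Fin (n' + 3)) ℂ) :=
    Matrix.of fun s t => C ((k + 1 : ℕ) : ℂ) * Q * pderiv s (pderiv t P) + P * pderiv s (pderiv t Q) with hMp
  set Mt : Matrix (Fin (n' + 3) × Fin (n' + 3)) (Fin (n' + 3) × Fin (n' + 3))
      (MvPolynomial (Fin (n' + 3) × Fin (n' + 3)) ℂ) :=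
    Matrix.of fun s t => C ((k + 1 : ℕ) : ℂ) * Qt * pderiv s (pderiv t P) +
        P * homogeneousComponent (d - 2) (pderiv s (pderiv t Q))
    with hMt
  have hMpdeg : ∀ s t, (Mp s t).totalDegree ≤ D := by
    intro s t
    rw [hMp, Matrix.of_apply]
    refine (totalDegree_add _ _).trans (max_le ?_ (hHQdeg s t))
    refine (totalDegree_mul _ _).trans ?_
    have h1 : (C ((k + 1 : ℕ) : ℂ) * Q).totalDegree ≤ d :=
      (totalDegree_mul _ _).trans_eq (by rw [totalDegree_C, zero_add])
    have h2 := hHPdeg s t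
    rw [hD]; omega
  have hMptop : Mp.map (homogeneousComponent D) = Mt := by
    ext s t
    rw [Matrix.map_apply, hMp, Matrix.of_apply, hMt, Matrix.of_apply, map_add, hD, hHQtop s t,
      mul_assoc, homogeneousComponent_C_mul,
      homogeneousComponent_mul_of_le le_rfl (hHPdeg s t), homogeneousComponent_eq_self (hHP s t),
      mul_assoc]
  -- `g = det M`, its top form `det Mt`
  set g := Mp.det with hg
  have hgdeg : g.totalDegree ≤ Fintype.card (Fin (n' + 3) × Fin (n' + 3)) * D :=
    totalDegree_det_le Mp hMpdeg
  have hgtop : homogeneousComponent (Fintype.card (Fin (n' + 3) × Fin (n' + 3)) * D) g = Mt.det := by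
    rw [hg, homogeneousComponent_det_of_le Mp hMpdeg, hMptop]
  -- a point `x₀ ∈ Z(P)` with `Qt(x₀) ≠ 0` and `det Hess P(x₀) ≠ 0` (prime avoidance)
  set HP : Matrix (Fin (n' + 3) × Fin (n' + 3)) (Fin (n' + 3) × Fin (n' + 3))
      (MvPolynomial (Fin (n' + 3) × Fin (n' + 3)) ℂ) :=
    Matrix.of fun s t => pderiv s (pderiv t P) with hHPdef
  have hx₀ : ∃ x₀ : Fin (n' + 3) × Fin (n' + 3) → ℂ, eval x₀ P = 0 ∧
      eval x₀ (Qt * HP.det) ≠ 0 := by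
    by_contra hall
    push Not at hall
    have hmem : Qt * HP.det ∈ vanishingIdeal ℂ (zeroLocus ℂ (Ideal.span {P})) := by
      rw [mem_vanishingIdeal_iff]
      intro x hx
      rw [zeroLocus_span] at hx
      have hPx : eval x P = 0 := hx P (Set.mem_singleton P)
      exact hall x hPx
    rw [vanishingIdeal_zeroLocus_eq_radical, Ideal.mem_radical_iff] at hmem
    obtain ⟨r, hr⟩ := hmem
    rw [Ideal.mem_span_singleton] at hr
    rcases hPprime.dvd_or_dvd (hPprime.dvd_of_dvd_pow hr) with h1 | h2
    · exact htop h1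
    · obtain ⟨w, hw⟩ := h2
      have := eval_mrPoint_det_hessP_perPoly_ne_zero n'
      rw [← hPdef, ← hHPdef, hw, map_mul, eval_mrPoint_perPoly, zero_mul] at this
      exact this rfl
  obtain ⟨x₀, hx₀P, hx₀F⟩ := hx₀
  rw [map_mul] at hx₀F
  have hx₀Qt : eval x₀ Qt ≠ 0 := left_ne_zero_of_mul hx₀F
  have hx₀H : eval x₀ HP.det ≠ 0 := right_ne_zero_of_mul hx₀F
  -- `det Mt (x₀) ≠ 0`, hence `det Mt ≠ 0`, `P ∤ det Mt`, `deg g = card · D`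
  have hMtx₀ : eval x₀ Mt.det ≠ 0 := by
    have hmap : (RingHom.mapMatrix (eval x₀)) Mt =
        (((k + 1 : ℕ) : ℂ) * eval x₀ Qt) • HP.map (eval x₀) := by
      ext s t
      rw [RingHom.mapMatrix_apply, Matrix.map_apply, hMt, Matrix.of_apply, Matrix.smul_apply,
        Matrix.map_apply, hHPdef, Matrix.of_apply, map_add, map_mul, map_mul, map_mul, eval_C, hx₀P,
        zero_mul, add_zero, smul_eq_mul]
    rw [RingHom.map_det, hmap, Matrix.det_smul, ← RingHom.mapMatrix_apply, ← RingHom.map_det]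
    exact mul_ne_zero (pow_ne_zero _ (mul_ne_zero (Nat.cast_ne_zero.mpr (Nat.succ_ne_zero k))
      hx₀Qt)) hx₀H
  have hMt0 : Mt.det ≠ 0 := fun h0 => hMtx₀ (by rw [h0, map_zero])
  have hPMt : ¬ P ∣ Mt.det := by
    rintro ⟨w, hw⟩
    exact hMtx₀ (by rw [hw, map_mul, hx₀P, zero_mul])
  have hgdeg' : g.totalDegree = Fintype.card (Fin (n' + 3) × Fin (n' + 3)) * D :=
    totalDegree_eq_of_homogeneousComponent_ne_zero hgdeg (by rw [hgtop]; exact hMt0)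
  have hg0 : g ≠ 0 := by
    intro h0; apply hMt0; rw [← hgtop, h0, map_zero]
  -- the top form of `h = det A`
  have hhtopdeg : (P ^ (k + 1)).totalDegree ≤ (n' + 3) * (k + 1) :=
    (totalDegree_pow _ _).trans (by rw [mul_comm]; exact Nat.mul_le_mul_right _ hPdeg)
  have hhdegle : A.det.totalDegree ≤ (n' + 3) * (k + 1) + d := by
    rw [hdet]
    refine (totalDegree_add _ _).trans (max_le ?_ ?_)
    · rw [totalDegree_C]; exact Nat.zero_le _
    · exact (totalDegree_mul _ _).trans (Nat.add_le_add hhtopdeg le_rfl)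
  have hhtop : homogeneousComponent ((n' + 3) * (k + 1) + d) A.det = P ^ (k + 1) * Qt := by
    rw [hdet, map_add, homogeneousComponent_of_mem (isHomogeneous_C _ c),
      if_neg (Nat.pos_iff_ne_zero.mp (Nat.add_pos_left (Nat.mul_pos (Nat.succ_pos _) (Nat.succ_pos _)) _)),
      zero_add, homogeneousComponent_mul_of_le hhtopdeg le_rfl,
      homogeneousComponent_eq_self (hPhom.pow (k + 1))]
  have hhdeg : A.det.totalDegree = (n' + 3) * (k + 1) + d :=
    totalDegree_eq_of_homogeneousComponent_ne_zero hhdegle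
      (by rw [hhtop]; exact mul_ne_zero (pow_ne_zero _ hPprime.ne_zero) hQt0)
  -- KEY: some zero of `h` is a point where `g ≠ 0`
  have hpt : ∃ x : Fin (n' + 3) × Fin (n' + 3) → ℂ, eval x A.det = 0 ∧ eval x g ≠ 0 := by
    by_contra hall
    push Not at hall
    have hmem : g ∈ vanishingIdeal ℂ (zeroLocus ℂ (Ideal.span {A.det})) := by
      rw [mem_vanishingIdeal_iff]
      intro x hx
      rw [zeroLocus_span] at hx
      have hhx : eval x A.det = 0 := hx A.det (Set.mem_singleton A.det)
      exact hall x hhx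
    rw [vanishingIdeal_zeroLocus_eq_radical, Ideal.mem_radical_iff] at hmem
    obtain ⟨r, hr⟩ := hmem
    rw [Ideal.mem_span_singleton] at hr
    obtain ⟨w, hw⟩ := hr
    have hw0 : w ≠ 0 := by
      intro h0; rw [h0, mul_zero] at hw; exact pow_ne_zero r hg0 hw
    have hh0 : A.det ≠ 0 := by
      intro h0; rw [h0, zero_mul] at hw; exact pow_ne_zero r hg0 hw
    -- degrees: `r · deg g = deg h + deg w`
    have hdegs : r * g.totalDegree = A.det.totalDegree + w.totalDegree := by
      rw [← totalDegree_pow_of_ne_zero hg0, hw, totalDegree_mul_of_isDomain hh0 hw0]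
    -- top components of both sides of `g^r = h w`
    have htops := congrArg (homogeneousComponent (r * g.totalDegree)) hw
    rw [homogeneousComponent_pow_of_le le_rfl, hdegs, homogeneousComponent_mul_totalDegree,
      hgdeg', hgtop, hhdeg, hhtop] at htops
    -- `P ∣ (det Mt)^r`
    apply hPMt
    refine hPprime.dvd_of_dvd_pow (n := r) ⟨P ^ k * Qt * homogeneousComponent w.totalDegree w, ?_⟩
    rw [htops]; ring
  obtain ⟨x, hxh, hxg⟩ := hpt
  -- at `x`: `P(x) ≠ 0`
  have hPx : eval x P ≠ 0 := by
    intro h0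
    rw [hdet, map_add, map_mul, map_pow, h0, eval_C, zero_pow (Nat.succ_ne_zero k),
      zero_mul, add_zero] at hxh
    exact hc hxh
  -- the Hessian of `h` at `x`
  have hrank_le : (hess0 (transl x A.det)).rank ≤ 2 * m := rank_hess0_transl_det_le' A hA x hxh
  obtain ⟨a, ha⟩ := hess0_pow_succ_mul (transl x P) k (transl x Q)
  have hHx : hess0 (transl x A.det) = hess0 ((transl x P) ^ (k + 1) * transl x Q) := by
    rw [hdet, map_add, transl_C, map_mul, map_pow, map_add,
      hess0_eq_zero_of_totalDegree_le_one (by rw [totalDegree_C]; exact Nat.zero_le _), zero_add]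
  -- the core matrix is `M(x)`
  have hcore : ((((k + 1 : ℕ) : ℂ) * constantCoeff (transl x Q)) • hess0 (transl x P) +
      constantCoeff (transl x P) • hess0 (transl x Q)) = (RingHom.mapMatrix (eval x)) Mp := by
    ext s t
    rw [RingHom.mapMatrix_apply, Matrix.map_apply, hMp, Matrix.of_apply, Matrix.add_apply,
      Matrix.smul_apply, Matrix.smul_apply, hess0_transl_eq_map, hess0_transl_eq_map,
      Matrix.map_apply, Matrix.map_apply, Matrix.of_apply, Matrix.of_apply, constantCoeff_transl,
      constantCoeff_transl, map_add, map_mul, map_mul, map_mul, eval_C, smul_eq_mul, smul_eq_mul]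
  have hrankM : ((RingHom.mapMatrix (eval x)) Mp).rank =
      Fintype.card (Fin (n' + 3) × Fin (n' + 3)) := by
    refine Matrix.rank_of_isUnit _ ((Matrix.isUnit_iff_isUnit_det _).mpr ?_)
    rw [← RingHom.map_det]
    exact isUnit_iff_ne_zero.mpr hxg
  have hcP : constantCoeff (transl x P) ^ k ≠ 0 := by
    rw [constantCoeff_transl]; exact pow_ne_zero k hPx
  have key := rank_le_rank_smul_add_symm_add_two hcP
    ((((k + 1 : ℕ) : ℂ) * constantCoeff (transl x Q)) • hess0 (transl x P) +
      constantCoeff (transl x P) • hess0 (transl x Q)) (linPart (transl x P)) a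
  rw [← ha, ← hHx, hcore, hrankM] at key
  have hcard : Fintype.card (Fin (n' + 3) × Fin (n' + 3)) = (n' + 3) ^ 2 := by
    rw [Fintype.card_prod, Fintype.card_fin, sq]
  omega

end UnitTop

end Summit.ValiantsHypothesis.ValiantsHypothesis.Theorems.GrenetZeonTwoDimCoefficients

end
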